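import Mathlib
import HarnessLib

/-!
# LatticeQCDFlow / Scaling — walks avoiding a vertex set: the fill-path calculus

HONEST FRAMING: exact (Metropolis-corrected) sampling algorithms for lattice gauge theory;
figures of merit are autocorrelation/cost numbers at stated couplings and volumes; no
continuum-physics claim.

Venture `LatticeQCDFlow` (cell pub-lqcd), topic `Scaling`, FANOUT row 30 (lean-1) — OUR WORK, a
helper file of the AUTOREGRESSIVE-CONTEXT (ELIMINATION-FRONT) VOLUME LAW.  For a simple graph `G`,
a vertex set `T` and vertices `i`, `j`, `AvoidWalk G T i j` says that some walk of `G` from `i` to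
`j` has all its vertices other than `i`, `j` OUTSIDE `T` (for `T = {b | a ≤ b}` and `a < i` this is
the lower-path relation of the tree's `EliminationGraph.lean`, i.e. the fill edge `{a, i}` of the
elimination graph, [VandenbergheAndersen2015, Thm 6.1]).  Lemmas: monotonicity in `T`, reversal,
concatenation through a vertex outside `T`, `avoidWalk_univ_iff` (avoiding everything = an edge)
and the SPLITTING LEMMA `avoidWalk_iff_of_insert`: for `a ∉ s`, `j ≠ a`, a walk avoiding `s`
either avoids `insert a s` or splits at `a` (pass to a path, cut at the unique visit of `a`) — the
combinatorial half of "no cancellation in the Cholesky factor of a Stieltjes matrix"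
(`Scaling/StieltjesCholeskyFill.lean`).  Elementary; nothing is cited as a fact; `def AvoidWalk`;
no `sorry`.
-/

namespace Summit.Ventures.LatticeQCDFlow.Theory2.Autoregressive

variable {ι : Type*}

/-! ## Walks avoiding a set -/

section Walks

/-- A walk of `G` from `i` to `j` all of whose vertices other than `i`, `j` lie OUTSIDE `T`.
[folklore] -/
def AvoidWalk (G : SimpleGraph ι) (T : Set ι) (i j : ι) : Prop :=
  ∃ p : G.Walk i j, ∀ z ∈ p.support, z = i ∨ z = j ∨ z ∉ T

variable {G : SimpleGraph ι}

/-- Avoiding a smaller set is easier. [folklore] -/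
theorem AvoidWalk.anti {T T' : Set ι} (h : T' ⊆ T) {i j : ι} (hw : AvoidWalk G T i j) :
    AvoidWalk G T' i j := by
  obtain ⟨p, hp⟩ := hw
  exact ⟨p, fun z hz => (hp z hz).imp_right (Or.imp_right fun hz' hT => hz' (h hT))⟩

/-- Reversal. [folklore] -/
theorem AvoidWalk.symm {T : Set ι} {i j : ι} (hw : AvoidWalk G T i j) : AvoidWalk G T j i := by
  obtain ⟨p, hp⟩ := hw
  refine ⟨p.reverse, fun z hz => ?_⟩
  rw [SimpleGraph.Walk.support_reverse, List.mem_reverse] at hz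
  rcases hp z hz with h | h | h
  exacts [Or.inr (Or.inl h), Or.inl h, Or.inr (Or.inr h)]

/-- Concatenation through a vertex outside the smaller set. [folklore] -/
theorem AvoidWalk.trans_of_notMem {T : Set ι} {i a j : ι} (ha : a ∉ T) (h₁ : AvoidWalk G T i a)
    (h₂ : AvoidWalk G T a j) : AvoidWalk G T i j := by
  obtain ⟨p, hp⟩ := h₁
  obtain ⟨q, hq⟩ := h₂
  refine ⟨p.append q, fun z hz => ?_⟩
  rw [SimpleGraph.Walk.mem_support_append_iff] at hz
  rcases hz with hz | hz
  · rcases hp z hz with h | h | h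
    exacts [Or.inl h, Or.inr (Or.inr (h ▸ ha)), Or.inr (Or.inr h)]
  · rcases hq z hz with h | h | h
    exacts [Or.inr (Or.inr (h ▸ ha)), Or.inr (Or.inl h), Or.inr (Or.inr h)]

/-- Between distinct vertices, a walk avoiding EVERYTHING is an edge (possibly retraced).
[folklore] -/
theorem avoidWalk_univ_iff {i j : ι} (hij : i ≠ j) : AvoidWalk G Set.univ i j ↔ G.Adj i j := by
  constructor
  · rintro ⟨p, hp⟩
    cases p with
    | nil => exact absurd rfl hij
    | cons h p' =>
      rename_i b
      rcases hp b (by simp) with hb | hb | hb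
      · exact absurd hb.symm h.ne
      · exact hb ▸ h
      · exact absurd (Set.mem_univ b) hb
  · intro h
    exact ⟨h.toWalk, fun z hz => by
      rw [SimpleGraph.Walk.support_cons, SimpleGraph.Walk.support_nil, List.mem_cons,
        List.mem_singleton] at hz
      exact hz.imp_right Or.inl⟩

/-- **Splitting at a vertex** (the fill-path calculus): for `a ∉ s` and `j ≠ a`, a walk avoiding
`s` either avoids `insert a s` or splits at `a` into two walks avoiding `insert a s`. [folklore] -/
theorem avoidWalk_iff_of_insert [DecidableEq ι] {s : Set ι} {a i j : ι} (ha : a ∉ s)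
    (hja : j ≠ a) :
    AvoidWalk G s i j ↔ AvoidWalk G (insert a s) i j ∨
      (AvoidWalk G (insert a s) i a ∧ AvoidWalk G (insert a s) a j) := by
  refine ⟨fun ⟨p₀, hp₀⟩ => ?_, fun h => ?_⟩
  · -- pass to a path and split at `a` if it is visited
    set p := p₀.bypass with hpdef
    have hp : ∀ z ∈ p.support, z = i ∨ z = j ∨ z ∉ s :=
      fun z hz => hp₀ z (p₀.support_bypass_subset_support hz)
    have hpath : p.IsPath := p₀.bypass_isPath
    by_cases has : a ∈ p.support
    · right
      set q₁ := p.takeUntil a has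
      set q₂ := p.dropUntil a has
      have hspec : q₁.append q₂ = p := p.take_spec has
      have hnodup : (q₁.support ++ q₂.support.tail).Nodup := by
        rw [← SimpleGraph.Walk.support_append, hspec]
        exact (SimpleGraph.Walk.isPath_def p).mp hpath
      have hj₂ : j ∈ q₂.support.tail := by
        have h := q₂.end_mem_support
        rw [← SimpleGraph.Walk.cons_tail_support] at h
        exact (List.mem_cons.mp h).resolve_left hja
      have hj₁ : j ∉ q₁.support := fun h => List.disjoint_of_nodup_append hnodup h hj₂
      have hi₂ : i ∉ q₂.support.tail := fun h =>
        List.disjoint_of_nodup_append hnodup q₁.start_mem_support h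
      refine ⟨⟨q₁, fun z hz => ?_⟩, ⟨q₂, fun z hz => ?_⟩⟩
      · have hzp : z ∈ p.support := p.support_takeUntil_subset_support has hz
        rcases hp z hzp with h | h | h
        · exact Or.inl h
        · exact absurd hz (h ▸ hj₁)
        · by_cases hza : z = a
          · exact Or.inr (Or.inl hza)
          · exact Or.inr (Or.inr (by simp [hza, h]))
      · have hzp : z ∈ p.support := p.support_dropUntil_subset_support has hz
        by_cases hza : z = a
        · exact Or.inl hza
        · have hzt : z ∈ q₂.support.tail := by
            rw [← SimpleGraph.Walk.cons_tail_support] at hz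
            exact (List.mem_cons.mp hz).resolve_left hza
          rcases hp z hzp with h | h | h
          · exact absurd hzt (h ▸ hi₂)
          · exact Or.inr (Or.inl h)
          · exact Or.inr (Or.inr (by simp [hza, h]))
    · left
      refine ⟨p, fun z hz => ?_⟩
      rcases hp z hz with h | h | h
      · exact Or.inl h
      · exact Or.inr (Or.inl h)
      · have hza : z ≠ a := fun h' => has (h' ▸ hz)
        exact Or.inr (Or.inr (by simp [hza, h]))
  · rcases h with h | ⟨h₁, h₂⟩
    · exact h.anti (Set.subset_insert a s)
    · exact (h₁.anti (Set.subset_insert a s)).trans_of_notMem ha (h₂.anti (Set.subset_insert a s))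

end Walks

end Summit.Ventures.LatticeQCDFlow.Theory2.Autoregressive
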